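import Literature.AlgebraicTopology.SingularHomology.CechSingular
import Literature.AlgebraicTopology.SingularHomology.CechSingularBridge
import Literature.Algebra.Homology.DoubleComplexNaturality
import HarnessLib

/-!
# The Čech-to-singular map of an arbitrary open family, and its restriction to open subsets

For a family `𝔘 = (U_i)` of subsets of a space `X` the rows of the Čech–singular double complex
`C^p(𝔘, C^q)` (`Literature.AlgebraicTopology.SingularHomology.CechSingular`) are exact with NO
hypothesis on `𝔘` (Bott–Tu (1982), Prop. 8.5 / the index-choice contraction), so the row
augmentation `Hⁿ(Hom(C^𝔘, N)) → Hⁿ(Tot)` by the `𝔘`-small cochains is bijective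
(`RowAugmentation.totEquiv`), while the column augmentation by the Čech complex `C^•(𝔘, Z⁰)` of
`0`-cocycles always MAPS into `Hⁿ(Tot)` (`RowAugmentation.totMap` of `cechSingularCol`). Composing,
every family carries a canonical map

  `cechToSmall : Hⁿ(C^•(𝔘, Z⁰), δ) → Hⁿ(Hom(C^𝔘, N))`

from the Čech cohomology of locally constant (`0`-cocycle) coefficients to the cohomology of the
small cochains (for an open cover: to `Hⁿ(⋃ U_i; N)`, Hatcher Prop. 2.21) — the edge homomorphism
of the Čech-to-derived-functor spectral sequence in degree `n` (Godement (1958), II.5.4; Bott–Tu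
(1982), Thm. 15.8 drops the acyclicity only for the inverse). This file records:

* `cechTotClass`, `cechToSmall` — the maps; `cechSingularEquiv_cechToSmall` — on a family whose
  finite intersections are acyclic it is the inverse of the comparison isomorphism
  `cechSingularEquiv`; `cechToSmall_mk_eq_mk_iff` — the class of a Čech cocycle `b` goes to the
  class of a small cocycle `a` iff `ε a` and `η b` are cohomologous in the total complex
  (the "collating zigzag" criterion);
* `restrictHom W`, `restrictRowHom W`, `restrictColHom W` — restriction of the double complex,
  of the small cochains and of the Čech complex from `𝔘` to the family `(U_i ∩ W)` of an
  arbitrary subset `W` (all cochains being computed inside `C(X)`, restriction is strictly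
  functorial), and **`cechToSmall_restrict`**: `cechToSmall` commutes with restriction;
* `cochainOfFun`, `evalSimplex_cochainOfFun`, `evalSimplex_cod_succ` — cochains of a subset defined
  by their values on simplices, and the values of a coboundary.

No named facts; everything is proved.

## References

* R. Bott, L. W. Tu, *Differential Forms in Algebraic Topology*, GTM 82, Springer 1982, §8
  Prop. 8.5, Prop. 8.8, Thm. 8.9; §15 Thm. 15.8. [BottTu1982Forms]
* R. Godement, *Topologie algébrique et théorie des faisceaux*, Hermann 1958, II.5.4.
* A. Hatcher, *Algebraic Topology*, CUP 2002, §2.1 Prop. 2.21, §3.1 p. 197. [HatcherAT2002]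
-/

noncomputable section

-- as in `CechSingular`: chains of the concrete complex are `Finsupp`s up to unfolding
set_option backward.isDefEq.respectTransparency false

open CategoryTheory Literature.Algebra.Homology

universe u v w

namespace Literature.AlgebraicTopology.SingularHomology

variable {R : Type v} [CommRing R] {X : Type u} [TopologicalSpace X]
  {N : Type w} [AddCommGroup N] [Module R N] {ι : Type*}

/-! ### Cochains of a subset given by their values on simplices -/

/-- **The cochain of `A` with prescribed values on simplices**: the linear extension of
`σ ↦ F σ` to the free module `C_q(A)` (Hatcher 2002, §3.1 p. 197: "a cochain is a function on
singular simplices"). [cite: HatcherAT2002, §3.1 p. 197] -/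
def cochainOfFun (A : Set X) (q : ℕ) (F : SingularSimplex X q → N) : CochainOn R N A q where
  toFun x := Finsupp.linearCombination R F x.1
  map_add' x y := map_add _ x.1 y.1
  map_smul' r x := map_smul _ r x.1

/-- The values of `cochainOfFun A q F` on the simplices of `A` are those of `F`. [folklore] -/
theorem evalSimplex_cochainOfFun {A : Set X} {q : ℕ} (F : SingularSimplex X q → N)
    {σ : SingularSimplex X q} (hσ : σ.range ⊆ A) :
    evalSimplex (cochainOfFun (R := R) A q F) σ = F σ := by
  rw [evalSimplex_of_subset _ hσ]
  change Finsupp.linearCombination R F (Finsupp.single σ 1) = F σ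
  rw [Finsupp.linearCombination_single, one_smul]

/-- **The values of a coboundary**: for a `(q+1)`-simplex `σ` of `A`,
`(δψ)(σ) = Σ_i (-1)^i ψ(σ ∘ δ_i)` (Hatcher 2002, §3.1 p. 197, `δ = ∂*`).
[cite: HatcherAT2002, §3.1 p. 197] -/
theorem evalSimplex_cod {A : Set X} {q : ℕ} (ψ : CochainOn R N A q) {σ : SingularSimplex X (q + 1)}
    (hσ : σ.range ⊆ A) :
    evalSimplex (cod A q ψ) σ = ∑ i : Fin (q + 2), (-1 : R) ^ (i : ℕ) • evalSimplex ψ (σ.face i) := by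
  rw [evalSimplex_of_subset _ hσ, cod_apply]
  have hd : (((chainsInSub R R X A).toComplex.d (q + 1) q).hom (elemChain hσ) :
      (chainsInSub R R X A).toComplex.X q) =
      ∑ i : Fin (q + 2), (-1 : R) ^ (i : ℕ) • elemChain (R := R)
        ((SingularSimplex.range_face_subset i σ).trans hσ) := by
    apply Subtype.ext
    rw [toComplex_d_val, coe_elemChain, csingularChainComplex.bd_single, Submodule.coe_sum]
    refine Finset.sum_congr rfl fun i _ ↦ ?_
    rw [Submodule.coe_smul, coe_elemChain]
  rw [hd, map_sum]
  refine Finset.sum_congr rfl fun i _ ↦ ?_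
  rw [map_smul, evalSimplex_of_subset _ ((SingularSimplex.range_face_subset i σ).trans hσ)]

/-! ### Finite intersections of a restricted family -/

omit [TopologicalSpace X] in
/-- The finite intersections of the restricted family `(U_i ∩ W)` over a NONEMPTY tuple:
`(U ∩ W)_J = U_J ∩ W`. [folklore] -/
theorem cechSet_inter (U : ι → Set X) (W : Set X) {m : ℕ} (J : Fin (m + 1) → ι) :
    cechSet (fun i ↦ U i ∩ W) J = cechSet U J ∩ W := by
  ext x
  simp only [mem_cechSet_iff, Set.mem_inter_iff]
  exact ⟨fun h ↦ ⟨fun k ↦ (h k).1, (h 0).2⟩, fun h k ↦ ⟨h.1 k, h.2⟩⟩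

omit [TopologicalSpace X] in
/-- `(U ∩ W)_J ⊆ U_J`. [folklore] -/
theorem cechSet_inter_subset (U : ι → Set X) (W : Set X) {m : ℕ} (J : Fin m → ι) :
    cechSet (fun i ↦ U i ∩ W) J ⊆ cechSet U J :=
  fun _ hx ↦ mem_cechSet_iff.2 fun k ↦ (mem_cechSet_iff.1 hx k).1

omit [TopologicalSpace X] in
/-- `(U ∩ W)_J ⊆ W` for a nonempty tuple. [folklore] -/
theorem cechSet_inter_subset_right (U : ι → Set X) (W : Set X) {m : ℕ} (J : Fin (m + 1) → ι) :
    cechSet (fun i ↦ U i ∩ W) J ⊆ W :=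
  fun _ hx ↦ (mem_cechSet_iff.1 hx 0).2

/-! ### The Čech-to-total and Čech-to-small maps -/

section Maps

variable (U : ι → Set X)

/-- **The class in `Hⁿ(Tot)` of a Čech cocycle of `0`-cocycles**: the column augmentation
`C^•(𝔘, Z⁰) → Tot` followed by the transposition `Hⁿ(Tot K.swap) ≃ Hⁿ(Tot K)` (Bott–Tu (1982),
§8, the inclusion of the bottom row). No hypothesis on `𝔘`. [cite: BottTu1982Forms, §8 Prop. 8.8] -/
def cechTotClass (n : ℕ) :
    NatCochain.Cohomology (cechZeroδ R N U) n →ₗ[R]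
      NatCochain.Cohomology (cechSingular R N U).totD n :=
  ((cechSingular R N U).swapTotEquiv n).symm.toLinearMap ∘ₗ (cechSingularCol R N U).totMap n

/-- **The Čech-to-small map** `Hⁿ(C^•(𝔘, Z⁰)) → Hⁿ(Hom(C^𝔘, N))` of an arbitrary family: the
class in the total complex read through the row augmentation, which is bijective since the rows
are exact with no hypothesis (Bott–Tu (1982), Prop. 8.5, Prop. 8.8). [cite: BottTu1982Forms, §8 Prop. 8.8] -/
def cechToSmall (n : ℕ) :
    NatCochain.Cohomology (cechZeroδ R N U) n →ₗ[R]
      NatCochain.Cohomology (cechSingularRow R N U).dA n :=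
  ((cechSingularRow R N U).totEquiv (cechSingular_rowExact U) (cechSingularRow_exact U) n).symm.toLinearMap
    ∘ₗ cechTotClass U n

/-- Unfolding: `totEquiv (cechToSmall c) = cechTotClass c`. [folklore] -/
theorem totEquiv_cechToSmall (n : ℕ) (c : NatCochain.Cohomology (cechZeroδ R N U) n) :
    (cechSingularRow R N U).totEquiv (cechSingular_rowExact U) (cechSingularRow_exact U) n
      (cechToSmall U n c) = cechTotClass U n c :=
  LinearEquiv.apply_symm_apply _ _

/-- Unfolding: `swapTotEquiv (cechTotClass c) = (cechSingularCol).totMap c`. [folklore] -/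
theorem swapTotEquiv_cechTotClass (n : ℕ) (c : NatCochain.Cohomology (cechZeroδ R N U) n) :
    (cechSingular R N U).swapTotEquiv n (cechTotClass U n c) = (cechSingularCol R N U).totMap n c :=
  LinearEquiv.apply_symm_apply _ _

/-- **On an acyclic family, `cechToSmall` inverts the comparison isomorphism**:
`cechSingularEquiv (cechToSmall c) = c` (Bott–Tu (1982), Thm. 8.9 / Thm. 15.8).
[cite: BottTu1982Forms, Thm. 15.8] -/
theorem cechSingularEquiv_cechToSmall
    (hacyc : ∀ (p q : ℕ) (J : Fin (p + 1) → ι) (ψ : CochainOn R N (cechSet U J) (q + 1)),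
      cod (cechSet U J) (q + 1) ψ = 0 → ∃ φ : CochainOn R N (cechSet U J) q, cod (cechSet U J) q φ = ψ)
    (n : ℕ) (c : NatCochain.Cohomology (cechZeroδ R N U) n) :
    cechSingularEquiv U hacyc n (cechToSmall U n c) = c := by
  change ((cechSingularCol R N U).totEquiv ((cechSingular R N U).rowExact_swap_iff.2
      (cechSingular_colExact U hacyc)) (cechSingularCol_exact U) n).symm
    ((cechSingular R N U).swapTotEquiv n
      ((cechSingularRow R N U).totEquiv (cechSingular_rowExact U) (cechSingularRow_exact U) n
        (cechToSmall U n c))) = c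
  rw [totEquiv_cechToSmall, swapTotEquiv_cechTotClass, LinearEquiv.symm_apply_eq]
  rfl

/-- The same, read as `(cechSingularEquiv)⁻¹ = cechToSmall`. [cite: BottTu1982Forms, Thm. 15.8] -/
theorem cechSingularEquiv_symm_apply
    (hacyc : ∀ (p q : ℕ) (J : Fin (p + 1) → ι) (ψ : CochainOn R N (cechSet U J) (q + 1)),
      cod (cechSet U J) (q + 1) ψ = 0 → ∃ φ : CochainOn R N (cechSet U J) q, cod (cechSet U J) q φ = ψ)
    (n : ℕ) (c : NatCochain.Cohomology (cechZeroδ R N U) n) :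
    (cechSingularEquiv U hacyc n).symm c = cechToSmall U n c := by
  rw [LinearEquiv.symm_apply_eq, cechSingularEquiv_cechToSmall]

/-- **Transposition preserves total coboundaries**: a homogeneous `x` is a total coboundary of
`K` iff its transpose is one of `K.swap`. [folklore] -/
theorem swapₗ_mem_totB_iff {Y : ℕ → ℕ → Type*} [∀ p q, AddCommGroup (Y p q)] [∀ p q, Module R (Y p q)]
    (K : ADoubleComplex R Y) {n : ℕ} {x : ∀ p q, Y p q} (hx : x ∈ ADoubleComplex.Tn R n) :
    ADoubleComplex.swapₗ R x ∈ K.swap.totB n ↔ x ∈ K.totB n := by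
  cases n with
  | zero =>
    simp only [ADoubleComplex.totB_zero, Submodule.mem_bot]
    constructor
    · intro h
      funext p q
      exact congr_fun (congr_fun h q) p
    · intro h
      rw [h, map_zero]
  | succ n =>
    rw [ADoubleComplex.totB_succ, ADoubleComplex.totB_succ, Submodule.mem_map, Submodule.mem_map]
    constructor
    · rintro ⟨y, hy, hyx⟩
      refine ⟨ADoubleComplex.swapₗ R y, ADoubleComplex.swapₗ_mem_Tn hy, ?_⟩
      funext p q
      have h := congr_fun (congr_fun hyx q) p
      have h2 := congr_fun (congr_fun (K.swap.swapₗ_totalD y) p) q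
      rw [ADoubleComplex.swapₗ_apply] at h2
      -- `K.swap.swap = K` definitionally
      exact h2.symm.trans h
    · rintro ⟨y, hy, rfl⟩
      exact ⟨ADoubleComplex.swapₗ R y, ADoubleComplex.swapₗ_mem_Tn hy, (K.swapₗ_totalD y).symm⟩

/-- **The collating criterion, abstractly.** For a row-exact augmented double complex `K` with
row augmentation `(A, ε)` and column augmentation `(B, η)`, cocycles `a ∈ Aⁿ`, `b ∈ Bⁿ`: the class
of `b` read in `Hⁿ(A)` through `Hⁿ(Tot K)` is the class of `a` iff `ε a − η b` (the latter
transposed into `Tot K`) is a total coboundary (Bott–Tu (1982), Prop. 9.5, the collating formula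
as a criterion). [cite: BottTu1982Forms, §9 Prop. 9.5] -/
theorem totEquiv_symm_swapTotEquiv_symm_totMap_eq_iff
    {Y : ℕ → ℕ → Type*} [∀ p q, AddCommGroup (Y p q)] [∀ p q, Module R (Y p q)]
    {K : ADoubleComplex R Y} {A : ℕ → Type*} [∀ n, AddCommGroup (A n)] [∀ n, Module R (A n)]
    {B : ℕ → Type*} [∀ n, AddCommGroup (B n)] [∀ n, Module R (B n)]
    (E : K.RowAugmentation A) (E' : K.ColAugmentation B) (hK : K.RowExact) (hE : E.Exact) (n : ℕ)
    (a : ↥(NatCochain.cocycles E.dA n)) (b : ↥(NatCochain.cocycles E'.dA n)) :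
    (E.totEquiv hK hE n).symm ((K.swapTotEquiv n).symm (E'.totMap n (NatCochain.Cohomology.mk _ n b))) =
        NatCochain.Cohomology.mk _ n a ↔
      ((E.εTot n a : ∀ p q, Y p q) - ADoubleComplex.swapₗ R (E'.εTot n b : ∀ p q, Y q p)) ∈ K.totB n := by
  rw [LinearEquiv.symm_apply_eq, LinearEquiv.symm_apply_eq]
  change E'.totMap n (NatCochain.Cohomology.mk _ n b) =
    K.swapTotEquiv n (E.totMap n (NatCochain.Cohomology.mk _ n a)) ↔ _
  have hxT : ((E.εTot n a : ∀ p q, Y p q) - ADoubleComplex.swapₗ R (E'.εTot n b : ∀ p q, Y q p)) ∈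
      ADoubleComplex.Tn R (X := Y) n :=
    Submodule.sub_mem _ (E.εTot n a).2 (ADoubleComplex.swapₗ_mem_Tn (E'.εTot n b).2)
  rw [E'.totMap_mk, E.totMap_mk, ADoubleComplex.swapTotEquiv, NatCochain.Cohomology.equivOfBijective_apply,
    NatCochain.Cohomology.map_mk, NatCochain.Cohomology.mk_eq_mk_iff,
    ← K.swap.mem_coboundaries_totD_iff, Submodule.coe_sub]
  simp only [NatCochain.Cohomology.coe_mapCocycles, ADoubleComplex.coe_swapTn]
  rw [← Submodule.neg_mem_iff, neg_sub, ← swapₗ_mem_totB_iff K hxT, map_sub]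
  rfl

/-- **The collating criterion.** For a Čech cocycle `b` of `0`-cocycles and a cocycle `a` of small
cochains, `cechToSmall [b] = [a]` iff the augmentation images `ε a` (column `0`) and `η b` (row
`0`, transposed) are cohomologous in the total complex: `ε a − η b = D y` for a homogeneous `y` of
degree `n − 1` (Bott–Tu (1982), Prop. 9.5, "the collating formula"; here only as a criterion).
[cite: BottTu1982Forms, §9 Prop. 9.5] -/
theorem cechToSmall_mk_eq_mk_iff (n : ℕ) (b : ↥(NatCochain.cocycles (cechZeroδ R N U) n))
    (a : ↥(NatCochain.cocycles (cechSingularRow R N U).dA n)) :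
    cechToSmall U n (NatCochain.Cohomology.mk _ n b) = NatCochain.Cohomology.mk _ n a ↔
      ((cechSingularRow R N U).εTot n a : ∀ p q, CechCochain R N U p q) -
          ADoubleComplex.swapₗ R ((cechSingularCol R N U).εTot n b : ∀ p q, CechCochain R N U q p) ∈
        (cechSingular R N U).totB n :=
  totEquiv_symm_swapTotEquiv_symm_totMap_eq_iff (cechSingularRow R N U) (cechSingularCol R N U)
    (cechSingular_rowExact U) (cechSingularRow_exact U) n a b

end Maps

/-! ### Restriction to a subset -/

section Restrict

variable (U : ι → Set X) (W : Set X)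

variable (R N) in
/-- Componentwise restriction of Čech cochains along `(U ∩ W)_J ⊆ U_J`. [folklore] -/
def restrictCochain (p q : ℕ) : CechCochain R N U p q →ₗ[R] CechCochain R N (fun i ↦ U i ∩ W) p q where
  toFun c J := cres (cechSet_inter_subset U W J) q (c J)
  map_add' c c' := by funext J; exact (cres (cechSet_inter_subset U W J) q).map_add (c J) (c' J)
  map_smul' r c := by funext J; exact (cres (cechSet_inter_subset U W J) q).map_smul r (c J)

/-- The components of `restrictCochain`. [folklore] -/
@[simp]
theorem restrictCochain_apply {p q : ℕ} (c : CechCochain R N U p q) (J : Fin (p + 1) → ι) :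
    restrictCochain R N U W p q c J = cres (cechSet_inter_subset U W J) q (c J) :=
  rfl

/-- Restriction commutes with the vertical differential `(-1)^p δ_sing`. [folklore] -/
theorem restrictCochain_cechd {p q : ℕ} (c : CechCochain R N U p q) :
    restrictCochain R N U W p (q + 1) (cechd R N U p q c) =
      cechd R N (fun i ↦ U i ∩ W) p q (restrictCochain R N U W p q c) := by
  funext J
  rw [restrictCochain_apply, cechd_apply, cechd_apply, LinearMap.map_smul, cres_cod, restrictCochain_apply]

/-- Restriction commutes with the Čech differential. [folklore] -/
theorem restrictCochain_cechδ {p q : ℕ} (c : CechCochain R N U p q) :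
    restrictCochain R N U W (p + 1) q (cechδ R N U p q c) =
      cechδ R N (fun i ↦ U i ∩ W) p q (restrictCochain R N U W p q c) := by
  funext J
  rw [restrictCochain_apply, cechδ_apply, cechδ_apply, map_sum]
  refine Finset.sum_congr rfl fun j _ ↦ ?_
  rw [LinearMap.map_smul, cres_cres, restrictCochain_apply, cres_cres]

/-- **Restriction of the Čech–singular double complex** from `𝔘` to the family `(U_i ∩ W)`:
componentwise restriction of cochains along `(U ∩ W)_J ⊆ U_J` (Bott–Tu (1982), §8, restriction
to a refinement, here the identity on indices). [cite: BottTu1982Forms, §8] -/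
def restrictHom : (cechSingular R N U).Hom (cechSingular R N fun i ↦ U i ∩ W) where
  f p q := restrictCochain R N U W p q
  f_d _ _ c := restrictCochain_cechd U W c
  f_δ _ _ c := restrictCochain_cechδ U W c

/-- The components of the restriction morphism. [folklore] -/
@[simp]
theorem restrictHom_f_apply {p q : ℕ} (c : CechCochain R N U p q) (J : Fin (p + 1) → ι) :
    (restrictHom (R := R) (N := N) U W).f p q c J = cres (cechSet_inter_subset U W J) q (c J) :=
  rfl

/-- `C^{𝔘 ∩ W} ≤ C^𝔘`: a `(U_i ∩ W)`-small chain is `𝔘`-small. [folklore] -/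
theorem smallSub_inter_le : smallSub R R X (fun i ↦ U i ∩ W) ≤ smallSub R R X U :=
  fun n ↦ iSup_mono fun _ ↦ chainsIn_mono R R Set.inter_subset_left n

variable (R N) in
/-- Restriction of small cochains `Hom(C^𝔘, N) → Hom(C^{𝔘 ∩ W}, N)` (precomposition with
`C^{𝔘 ∩ W} ≤ C^𝔘`). [folklore] -/
def restrictSmall (q : ℕ) : SmallCochain R N U q →ₗ[R] SmallCochain R N (fun i ↦ U i ∩ W) q where
  toFun a := a ∘ₗ ((Subcomplex.incl (smallSub_inter_le (R := R) U W)).f q).hom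
  map_add' _ _ := LinearMap.add_comp _ _ _
  map_smul' _ _ := LinearMap.smul_comp _ _ _

/-- `restrictSmall`, applied. [folklore] -/
theorem restrictSmall_apply {q : ℕ} (a : SmallCochain R N U q)
    (x : (smallSub R R X fun i ↦ U i ∩ W).toComplex.X q) :
    restrictSmall R N U W q a x = a (((Subcomplex.incl (smallSub_inter_le (R := R) U W)).f q).hom x) :=
  rfl

/-- **Restriction of small cochains** as a morphism of row augmentations over `restrictHom`.
[cite: BottTu1982Forms, §8] -/
def restrictRowHom : ADoubleComplex.RowAugmentation.Hom (cechSingularRow R N U)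
    (cechSingularRow R N fun i ↦ U i ∩ W) (restrictHom U W) where
  g q := restrictSmall R N U W q
  g_dA q a := by
    change (a ∘ₗ ((smallSub R R X U).toComplex.d (q + 1) q).hom) ∘ₗ
        ((Subcomplex.incl (smallSub_inter_le (R := R) U W)).f (q + 1)).hom =
      (a ∘ₗ ((Subcomplex.incl (smallSub_inter_le (R := R) U W)).f q).hom) ∘ₗ
        ((smallSub R R X fun i ↦ U i ∩ W).toComplex.d (q + 1) q).hom
    have hc := congrArg (ModuleCat.Hom.hom (R := R))
      ((Subcomplex.incl (smallSub_inter_le (R := R) U W)).comm (q + 1) q)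
    rw [ModuleCat.hom_comp, ModuleCat.hom_comp] at hc
    rw [LinearMap.comp_assoc, hc, ← LinearMap.comp_assoc]
  ε_g q a := by
    funext J
    exact LinearMap.ext fun x ↦ rfl

/-- The restriction of small cochains of `restrictRowHom`, applied. [folklore] -/
theorem restrictRowHom_g_apply {q : ℕ} (a : SmallCochain R N U q)
    (x : (smallSub R R X fun i ↦ U i ∩ W).toComplex.X q) :
    (restrictRowHom (R := R) (N := N) U W).g q a x =
      a (((Subcomplex.incl (smallSub_inter_le (R := R) U W)).f q).hom x) :=
  rfl

variable (R N) in
/-- Restriction of Čech cochains of `0`-cocycles. [folklore] -/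
def restrictZero (p : ℕ) : CechZeroCocycles R N U p →ₗ[R] CechZeroCocycles R N (fun i ↦ U i ∩ W) p where
  toFun b J := ⟨cres (cechSet_inter_subset U W J) 0 (b J), cres_mem_zeroCocycles _ (b J).2⟩
  map_add' b b' := by
    funext J; apply Subtype.ext
    exact (cres (cechSet_inter_subset U W J) 0).map_add (b J : CochainOn R N _ 0) (b' J)
  map_smul' r b := by
    funext J; apply Subtype.ext
    exact (cres (cechSet_inter_subset U W J) 0).map_smul r (b J : CochainOn R N _ 0)

/-- `restrictZero` on underlying cochains. [folklore] -/
@[simp]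
theorem coe_restrictZero_apply {p : ℕ} (b : CechZeroCocycles R N U p) (J : Fin (p + 1) → ι) :
    (restrictZero R N U W p b J : CochainOn R N _ 0) =
      cres (cechSet_inter_subset U W J) 0 (b J : CochainOn R N (cechSet U J) 0) :=
  rfl

/-- Restriction commutes with the Čech differential on `0`-cocycles. [folklore] -/
theorem restrictZero_cechZeroδ {p : ℕ} (b : CechZeroCocycles R N U p) :
    restrictZero R N U W (p + 1) (cechZeroδ R N U p b) =
      cechZeroδ R N (fun i ↦ U i ∩ W) p (restrictZero R N U W p b) := by
  funext J
  apply Subtype.ext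
  rw [coe_restrictZero_apply, coe_cechZeroδ_apply, coe_cechZeroδ_apply, map_sum]
  refine Finset.sum_congr rfl fun j _ ↦ ?_
  rw [LinearMap.map_smul, cres_cres, coe_restrictZero_apply, cres_cres]

/-- **Restriction of the Čech complex of `0`-cocycles**, as a morphism of column augmentations
over `restrictHom`. [cite: BottTu1982Forms, §8] -/
def restrictColHom : ADoubleComplex.RowAugmentation.Hom (cechSingularCol R N U)
    (cechSingularCol R N fun i ↦ U i ∩ W) (restrictHom U W).swap where
  g p := restrictZero R N U W p
  g_dA _ b := restrictZero_cechZeroδ U W b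
  ε_g _ _ := rfl

/-- The restriction of Čech cochains of `0`-cocycles, on underlying cochains. [folklore] -/
theorem coe_restrictColHom_g_apply {p : ℕ} (b : CechZeroCocycles R N U p) (J : Fin (p + 1) → ι) :
    ((restrictColHom (R := R) (N := N) U W).g p b J : CochainOn R N _ 0) =
      cres (cechSet_inter_subset U W J) 0 (b J : CochainOn R N (cechSet U J) 0) :=
  rfl

/-- **`cechTotClass` commutes with restriction.** [cite: BottTu1982Forms, §8] -/
theorem cechTotClass_restrict (n : ℕ) (c : NatCochain.Cohomology (cechZeroδ R N U) n) :
    (restrictHom U W).totCohMap n (cechTotClass U n c) =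
      cechTotClass (fun i ↦ U i ∩ W) n ((restrictColHom U W).cohMap n c) := by
  apply ((cechSingular R N fun i ↦ U i ∩ W).swapTotEquiv n).injective
  rw [swapTotEquiv_cechTotClass, (restrictHom U W).swapTotEquiv_totCohMap, swapTotEquiv_cechTotClass]
  exact ((restrictColHom U W).totMap_cohMap n c).symm

/-- **`cechToSmall` commutes with restriction**: restricting a Čech class to `(U_i ∩ W)` and then
mapping to the small cochains of the restricted family is restricting the small class
(Bott–Tu (1982), §8: the Čech–de Rham maps are natural under restriction). [cite: BottTu1982Forms, §8] -/
theorem cechToSmall_restrict (n : ℕ) (c : NatCochain.Cohomology (cechZeroδ R N U) n) :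
    (restrictRowHom U W).cohMap n (cechToSmall U n c) =
      cechToSmall (fun i ↦ U i ∩ W) n ((restrictColHom U W).cohMap n c) := by
  rw [cechToSmall, LinearMap.comp_apply, LinearEquiv.coe_toLinearMap,
    ← (restrictRowHom U W).totEquiv_symm_totCohMap (cechSingular_rowExact U) (cechSingularRow_exact U)
      (cechSingular_rowExact _) (cechSingularRow_exact _), cechTotClass_restrict]
  rfl

end Restrict

/-! ### From small cochains back to all cochains of the covered set -/

section SmallToSubset

variable {N' : Type (max u v)} [AddCommGroup N'] [Module R N'] (U : ι → Set X)

variable (R N') in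
/-- Restriction of a cochain of `Y ⊇ U_i` to the `𝔘`-small chains (Hatcher 2002, §3.1 p. 204,
`Cⁿ(X) → Cⁿ(A + B)`). [cite: HatcherAT2002, §3.1 p. 204] -/
def toSmall {Y : Set X} (hUY : ∀ i, U i ⊆ Y) (q : ℕ) : CochainOn R N' Y q →ₗ[R] SmallCochain R N' U q where
  toFun ψ := ψ ∘ₗ ((Subcomplex.incl (smallSub_le_chainsInSub R R hUY)).f q).hom
  map_add' _ _ := LinearMap.add_comp _ _ _
  map_smul' _ _ := LinearMap.smul_comp _ _ _

/-- `toSmall`, applied. [folklore] -/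
theorem toSmall_apply {Y : Set X} (hUY : ∀ i, U i ⊆ Y) {q : ℕ} (ψ : CochainOn R N' Y q)
    (x : (smallSub R R X U).toComplex.X q) :
    toSmall R N' U hUY q ψ x = ψ (((Subcomplex.incl (smallSub_le_chainsInSub R R hUY)).f q).hom x) :=
  rfl

/-- Restriction to small chains commutes with the coboundaries. [folklore] -/
theorem toSmall_cod {Y : Set X} (hUY : ∀ i, U i ⊆ Y) {q : ℕ} (ψ : CochainOn R N' Y q) :
    toSmall R N' U hUY (q + 1) (cod Y q ψ) = (cechSingularRow R N' U).dA q (toSmall R N' U hUY q ψ) := by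
  change (ψ ∘ₗ ((chainsInSub R R X Y).toComplex.d (q + 1) q).hom) ∘ₗ
      ((Subcomplex.incl (smallSub_le_chainsInSub R R hUY)).f (q + 1)).hom =
    (ψ ∘ₗ ((Subcomplex.incl (smallSub_le_chainsInSub R R hUY)).f q).hom) ∘ₗ
      ((smallSub R R X U).toComplex.d (q + 1) q).hom
  have hc := congrArg (ModuleCat.Hom.hom (R := R))
    ((Subcomplex.incl (smallSub_le_chainsInSub R R hUY (U := U))).comm (q + 1) q)
  rw [ModuleCat.hom_comp, ModuleCat.hom_comp] at hc
  rw [LinearMap.comp_assoc, hc, ← LinearMap.comp_assoc]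

/-- The values of `toSmall ψ` on small simplices are those of `ψ`. [folklore] -/
theorem toSmall_elemChain {Y : Set X} (hUY : ∀ i, U i ⊆ Y) {q : ℕ} (ψ : CochainOn R N' Y q)
    {σ : SingularSimplex X q} {i : ι} (hσ : σ.range ⊆ U i) :
    toSmall R N' U hUY q ψ ⟨Finsupp.single σ 1, (smallSub R R X U).toComplex.X q |>.2 |> fun _ ↦
      le_iSup (fun i ↦ chainsIn R R X (U i) q) i (single_mem_chainsIn R R hσ 1)⟩ =
      evalSimplex ψ σ := by
  rw [toSmall_apply, evalSimplex_of_subset _ (hσ.trans (hUY i))]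
  rfl

/-- A cocycle of `Y` restricts to a cocycle of small cochains. [folklore] -/
theorem toSmall_mem_cocycles {Y : Set X} (hUY : ∀ i, U i ⊆ Y) {q : ℕ} {ψ : CochainOn R N' Y q}
    (hψ : cod Y q ψ = 0) : toSmall R N' U hUY q ψ ∈ NatCochain.cocycles (cechSingularRow R N' U).dA q := by
  rw [NatCochain.mem_cocycles_iff, ← toSmall_cod, hψ, map_zero]

/-- **Small cochains detect coboundaries** (Hatcher 2002, Prop. 2.21 dualised, §3.1 p. 204): for
an OPEN family `𝔘` and `U_i ⊆ Y ⊆ ⋃ U_i`, a cocycle `ψ` of `Y` whose restriction to the `𝔘`-small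
chains is a coboundary of small cochains is itself a coboundary. (The restriction
`Hom(C(Y), N) → Hom(C^𝔘, N)` is a quasi-isomorphism, being dual to one between complexes of free
modules.) [cite: HatcherAT2002, Prop. 2.21 and §3.1 p. 204] -/
theorem exists_cod_eq_of_mk_toSmall_eq_zero (hU : ∀ i, IsOpen (U i)) {Y : Set X}
    (hUY : ∀ i, U i ⊆ Y) (hYU : Y ⊆ ⋃ i, U i) {n : ℕ} (ψ : CochainOn R N' Y (n + 1))
    (hψ : cod Y (n + 1) ψ = 0)
    (h0 : NatCochain.Cohomology.mk (cechSingularRow R N' U).dA (n + 1)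
      ⟨toSmall R N' U hUY (n + 1) ψ, toSmall_mem_cocycles U hUY hψ⟩ = 0) :
    ∃ φ : CochainOn R N' Y n, cod Y n φ = ψ := by
  -- the dual of the inclusion of the small chains is a quasi-isomorphism
  set inc := Subcomplex.incl (smallSub_le_chainsInSub R R hUY (U := U)) with hinc
  haveI : QuasiIso inc := ⟨fun k ↦ by
    rw [quasiIsoAt_iff_isIso_homologyMap]
    exact isIso_homologyMap_incl_smallSub R R U hU hUY hYU k⟩
  haveI := isIso_homologyMap_dualMap_of_quasiIso (R := R) (N := ModuleCat.of R N') inc (n + 1)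
  have hinj := (homologyMap_injective_iff
    (dualMap R (ModuleCat.of R N') inc) (i := n + 1)).1
    (ConcreteCategory.bijective_of_isIso
      (HomologicalComplex.homologyMap (dualMap R (ModuleCat.of R N') inc) (n + 1))).1
  have hnext : ∀ m, (ComplexShape.down ℕ).symm.next m = m + 1 := fun m ↦ (ComplexShape.down ℕ).symm.next_eq' rfl
  have hprev : ∀ m, (ComplexShape.down ℕ).symm.prev (m + 1) = m := fun m ↦ (ComplexShape.down ℕ).symm.prev_eq' rfl
  -- `ψ` as a cycle of `Hom(C(Y), N)`
  have hz : (ModuleCat.ofHom ψ : (subsetCochains R (ModuleCat.of R N') Y).X (n + 1)) ∈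
      NatCochain.cocycles (natD (subsetCochains R (ModuleCat.of R N') Y)) (n + 1) := by
    rw [NatCochain.mem_cocycles_iff, natD_apply, dualObj_d_apply]
    apply ModuleCat.hom_ext
    rw [ModuleCat.hom_comp, ModuleCat.hom_ofHom, ModuleCat.hom_zero]
    exact hψ
  -- its restriction is a coboundary of small cochains
  obtain ⟨a, ha⟩ := (NatCochain.mem_coboundaries_succ_iff _).1
    ((NatCochain.Cohomology.mk_eq_zero_iff _ _).1 h0)
  have hb : ∃ w : (dualObj R (ModuleCat.of R N') (smallSub R R X U).toComplex).X
      ((ComplexShape.down ℕ).symm.prev (n + 1)),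
      (dualObj R (ModuleCat.of R N') (smallSub R R X U).toComplex).d _ (n + 1) w =
        (dualMap R (ModuleCat.of R N') inc).f (n + 1) (ModuleCat.ofHom ψ) := by
    rw [exists_d_prev_eq_iff (hprev n)]
    refine ⟨ModuleCat.ofHom a, ?_⟩
    rw [dualObj_d_apply, dualMap_f_apply]
    apply ModuleCat.hom_ext
    rw [ModuleCat.hom_comp, ModuleCat.hom_ofHom, ModuleCat.hom_comp, ModuleCat.hom_ofHom]
    exact ha
  obtain ⟨w, hw⟩ := (exists_d_prev_eq_iff (K := subsetCochains R (ModuleCat.of R N') Y) (hprev n)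
    (ModuleCat.ofHom ψ)).1 (hinj (ModuleCat.ofHom ψ) (d_next_eq_zero_of_mem_cocycles _ hnext hz) hb)
  refine ⟨w.hom, ?_⟩
  have h := congrArg (ModuleCat.Hom.hom (R := R)) hw
  rw [dualObj_d_apply, ModuleCat.hom_comp, ModuleCat.hom_ofHom] at h
  exact h

end SmallToSubset

end Literature.AlgebraicTopology.SingularHomology

end
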